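import Summits.AtomisticToContinuum.HydrodynamicLimit.Theses.CollisionIsometryCLT

/-!
# drefute evidence for `Lines/contact-source-duhamel.lean`, stub 1 (`stub_duhamel`)

All definitions below (`tpow`, `mapT`, `projM`, `coprojM`, `projV`, `coprojV`, `crossT`, `pre`,
`stepMap`, `transferSteps`, `stepPair`, `stepNormal`, `velAfter`, `tStep`, `tTransport`, `src`,
`DuhamelIdentity`) are VERBATIM copies of the skeleton's (namespace `…ContactSourceDuhamel.DrefuteDuhamel`),
so `duhamel_holds : ∀ σ, DuhamelIdentity σ` transplants to `Holds.stub_duhamel` by renaming the namespace.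

* `tpow_add_split` — binomial split of `tpow r (a + b)` into the two pure powers and `crossT` (`0 < r`;
  false at `r = 0`, where it reads `1 = 2`);
* `mapT_tpow`, `projM_apply`, `coprojM_apply` — `mapT (coprojM n) (tpow r a) = tpow r (coprojV n a)` etc.
  (no case split at `n = 0`: both sides carry the same `x / ‖n‖²`);
* `tpow_reflect` — ingredient (ii) of the stub docstring;
* `tStep_add/_zero/_sum`, `tTransport_zero/_succ`, `velAfter_succ` — bookkeeping;
* `oneStep` — `Y^{(m+1)} = tStep_m Y^{(m)} + src_m` (reflection law `collidePair_apply_left/right/of_ne`,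
  the shift `u` passes through `Q + P = 1` via `module`);
* `duhamel_holds` — induction on `m` (`Finset.sum_range_succ`, `List.range'_1_concat`).

`lean check`: rc 0, 0 sorries, axioms {propext, Classical.choice, Quot.sound}.
-/

namespace Summit.AtomisticToContinuum.HydrodynamicLimit.Cruxes.AdaptedWeightCLT.ContactSourceDuhamel.DrefuteDuhamel

open scoped BigOperators Topology Classical MeasureTheory ENNReal InnerProductSpace
open Filter Set MeasureTheory

noncomputable section

abbrev T3 : Type := UnitAddTorus (Fin 3)
abbrev V3 : Type := EuclideanSpace ℝ (Fin 3)
abbrev Cfg (N : ℕ) : Type := Literature.Analysis.FluidPDE.Config (N + 1) (Fin 3) T3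
abbrev Vel (N : ℕ) : Type := Fin (N + 1) → V3
abbrev Mat3 : Type := Fin 3 → Fin 3 → ℝ
abbrev Tens (r : ℕ) : Type := (Fin r → Fin 3) → ℝ

def tpow (r : ℕ) (y : V3) : Tens r := fun idx => ∏ s : Fin r, y (idx s)

def mapT {r : ℕ} (P : Mat3) (T : Tens r) : Tens r :=
  fun idx => ∑ idx' : Fin r → Fin 3, (∏ s : Fin r, P (idx s) (idx' s)) * T idx'

def projM (n : V3) : Mat3 := fun a b => n a * n b / ‖n‖ ^ 2
def coprojM (n : V3) : Mat3 := fun a b => (if a = b then 1 else 0) - n a * n b / ‖n‖ ^ 2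
def projV (n y : V3) : V3 := (inner ℝ n y / ‖n‖ ^ 2) • n
def coprojV (n y : V3) : V3 := y - projV n y

def crossT (r : ℕ) (qa pb : V3) : Tens r :=
  fun idx => ∑ S ∈ (Finset.univ : Finset (Finset (Fin r))).filter (fun S => S ≠ ∅ ∧ S ≠ Finset.univ),
    ∏ s : Fin r, (if s ∈ S then pb (idx s) else qa (idx s))

/-! ## Tensor algebra -/

theorem mapT_add {r : ℕ} (P : Mat3) (S T : Tens r) : mapT P (S + T) = mapT P S + mapT P T := by
  funext idx
  simp only [mapT, Pi.add_apply, mul_add, Finset.sum_add_distrib]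

/-- `mapT P` of a rank-one power is the power of the matrix image. -/
theorem mapT_tpow {r : ℕ} (P : Mat3) (y : V3) :
    mapT P (tpow r y) = tpow r (WithLp.toLp 2 fun c => ∑ b, P c b * y b) := by
  funext idx
  simp only [mapT, tpow]
  rw [Fintype.prod_sum (fun s b => P (idx s) b * y b)]
  refine Finset.sum_congr rfl fun idx' _ => ?_
  rw [Finset.prod_mul_distrib]

theorem inner_eq_sum (n y : V3) : inner ℝ n y = ∑ b, n b * y b := by
  simp [PiLp.inner_apply, mul_comm]

theorem projM_apply (n y : V3) : (WithLp.toLp 2 fun c => ∑ b, projM n c b * y b) = projV n y := by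
  ext c
  simp only [projM, projV, PiLp.smul_apply, smul_eq_mul, inner_eq_sum]
  rw [div_mul_eq_mul_div, Finset.sum_mul, Finset.sum_div]
  refine Finset.sum_congr rfl fun b _ => ?_
  ring

theorem coprojM_apply (n y : V3) : (WithLp.toLp 2 fun c => ∑ b, coprojM n c b * y b) = coprojV n y := by
  ext c
  have h := congrArg (fun v : V3 => v c) (projM_apply n y)
  simp only at h
  simp only [coprojM, coprojV, PiLp.sub_apply, sub_mul, Finset.sum_sub_distrib, ← h, projM]
  congr 1
  simp [Finset.sum_ite_eq, ite_mul]

/-- The binomial split of a rank-`r` power of a sum, `0 < r`. -/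
theorem tpow_add_split {r : ℕ} (hr : 0 < r) (qa pb : V3) :
    tpow r (qa + pb) = tpow r qa + tpow r pb + crossT r qa pb := by
  haveI : Nonempty (Fin r) := ⟨⟨0, hr⟩⟩
  funext idx
  simp only [tpow, crossT, Pi.add_apply]
  have h1 : ∏ s, (qa + pb) (idx s) = ∑ t : Finset (Fin r), (∏ s ∈ t, pb (idx s)) * ∏ s ∈ tᶜ, qa (idx s) := by
    have : ∀ s, (qa + pb) (idx s) = pb (idx s) + qa (idx s) := fun s => by
      rw [PiLp.add_apply, add_comm]
    simp_rw [this]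
    exact Fintype.prod_add _ _
  have h2 : ∀ t : Finset (Fin r), (∏ s, if s ∈ t then pb (idx s) else qa (idx s))
      = (∏ s ∈ t, pb (idx s)) * ∏ s ∈ tᶜ, qa (idx s) := by
    intro t
    rw [Finset.prod_ite]
    congr 1
    · apply Finset.prod_congr _ (fun _ _ => rfl); ext s; simp
    · apply Finset.prod_congr _ (fun _ _ => rfl); ext s; simp [Finset.mem_compl]
  rw [h1]
  simp_rw [h2]
  have hne : (Finset.univ : Finset (Fin r)) ≠ ∅ := Finset.univ_nonempty.ne_empty
  have hmem : (Finset.univ : Finset (Fin r)) ∈ (Finset.univ : Finset (Finset (Fin r))).erase ∅ :=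
    Finset.mem_erase.2 ⟨hne, Finset.mem_univ _⟩
  rw [← Finset.add_sum_erase _ _ (Finset.mem_univ (∅ : Finset (Fin r))), ← Finset.add_sum_erase _ _ hmem]
  have hfilter : ((Finset.univ : Finset (Finset (Fin r))).erase ∅).erase Finset.univ
      = (Finset.univ : Finset (Finset (Fin r))).filter (fun S => S ≠ ∅ ∧ S ≠ Finset.univ) := by
    ext S
    simp only [Finset.mem_erase, Finset.mem_filter, Finset.mem_univ, true_and, and_true]
    tauto
  rw [hfilter]
  simp only [Finset.prod_empty, one_mul, mul_one, Finset.compl_empty, Finset.compl_univ, add_assoc]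

/-- **Ingredient (ii) of `stub_duhamel`**: the reflection binomial identity, all ranks `r ≥ 1`. -/
theorem tpow_reflect {r : ℕ} (hr : 0 < r) (n a b : V3) :
    tpow r (coprojV n a + projV n b)
      = mapT (coprojM n) (tpow r a) + mapT (projM n) (tpow r b) + crossT r (coprojV n a) (projV n b) := by
  rw [tpow_add_split hr, mapT_tpow, mapT_tpow, coprojM_apply, projM_apply]


/-! ## The fold (verbatim copies of the skeleton's definitions) -/

def pre (σ : ℝ) (N : ℕ) (y : Cfg N) (k : ℕ) : Cfg N :=
  Literature.Analysis.FluidPDE.freeFlight (Literature.Analysis.FluidPDE.Torus.geometry (Fin 3))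
    (Literature.Analysis.FluidPDE.Alexander.freeExitTime
      (Literature.Analysis.FluidPDE.Torus.geometry (Fin 3))
      (Literature.MathematicalPhysics.KineticTheory.hsDiameter σ N)
      (Literature.Analysis.FluidPDE.Alexander.stateAfter
        (Literature.Analysis.FluidPDE.Torus.geometry (Fin 3))
        (Literature.MathematicalPhysics.KineticTheory.hsDiameter σ N) y k)).toReal
    (Literature.Analysis.FluidPDE.Alexander.stateAfter
      (Literature.Analysis.FluidPDE.Torus.geometry (Fin 3))
      (Literature.MathematicalPhysics.KineticTheory.hsDiameter σ N) y k)

def stepMap (σ : ℝ) (N : ℕ) (y : Cfg N) (k : ℕ) (W : Vel N) : Vel N :=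
  @dite (Fin (N + 1) → EuclideanSpace ℝ (Fin 3))
    (Literature.Analysis.FluidPDE.Alexander.incomingPairs
      (Literature.Analysis.FluidPDE.Torus.geometry (Fin 3))
      (Literature.MathematicalPhysics.KineticTheory.hsDiameter σ N) (pre σ N y k)).Nonempty
    (Classical.propDecidable _)
    (fun h => fun i => (Literature.Analysis.FluidPDE.collidePair
      (Literature.Analysis.FluidPDE.Torus.geometry (Fin 3)) h.some.1 h.some.2
      (fun j => ((pre σ N y k j).1, W j)) i).2)
    (fun _ => W)

def transferSteps (σ : ℝ) (N : ℕ) (y : Cfg N) (m : ℕ) (W : Vel N) : Vel N :=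
  (List.range m).foldl (fun W' k => stepMap σ N y k W') W

def stepPair (σ : ℝ) (N : ℕ) (y : Cfg N) (k : ℕ) : Option (Fin (N + 1) × Fin (N + 1)) :=
  @dite (Option (Fin (N + 1) × Fin (N + 1)))
    (Literature.Analysis.FluidPDE.Alexander.incomingPairs
      (Literature.Analysis.FluidPDE.Torus.geometry (Fin 3))
      (Literature.MathematicalPhysics.KineticTheory.hsDiameter σ N) (pre σ N y k)).Nonempty
    (Classical.propDecidable _)
    (fun h => some h.some) (fun _ => none)

def stepNormal (σ : ℝ) (N : ℕ) (y : Cfg N) (k : ℕ) : V3 :=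
  match stepPair σ N y k with
  | none => 0
  | some ij => (Literature.Analysis.FluidPDE.Torus.geometry (Fin 3)).sepVec
      (pre σ N y k ij.1).1 (pre σ N y k ij.2).1

def velAfter (σ : ℝ) (N : ℕ) (y : Cfg N) (m : ℕ) : Vel N :=
  transferSteps σ N y m (fun i => (y i).2)

def tStep (r : ℕ) (σ : ℝ) (N : ℕ) (y : Cfg N) (k : ℕ) (T : Fin (N + 1) → Tens r) :
    Fin (N + 1) → Tens r :=
  match stepPair σ N y k with
  | none => T
  | some ij =>
    Function.update (Function.update T ij.1
        (mapT (coprojM (stepNormal σ N y k)) (T ij.1) + mapT (projM (stepNormal σ N y k)) (T ij.2)))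
      ij.2 (mapT (coprojM (stepNormal σ N y k)) (T ij.2) + mapT (projM (stepNormal σ N y k)) (T ij.1))

def tTransport (r : ℕ) (σ : ℝ) (N : ℕ) (y : Cfg N) (m₁ n : ℕ) (T : Fin (N + 1) → Tens r) :
    Fin (N + 1) → Tens r :=
  (List.range' m₁ n).foldl (fun T' k => tStep r σ N y k T') T

def src (r : ℕ) (σ : ℝ) (N : ℕ) (y : Cfg N) (u : V3) (l : ℕ) : Fin (N + 1) → Tens r :=
  match stepPair σ N y l with
  | none => 0
  | some ij =>
    Function.update (Function.update 0 ij.1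
        (crossT r (coprojV (stepNormal σ N y l) (velAfter σ N y l ij.1 - u))
          (projV (stepNormal σ N y l) (velAfter σ N y l ij.2 - u))))
      ij.2 (crossT r (coprojV (stepNormal σ N y l) (velAfter σ N y l ij.2 - u))
          (projV (stepNormal σ N y l) (velAfter σ N y l ij.1 - u)))

def DuhamelIdentity (σ : ℝ) : Prop :=
  ∀ (r N : ℕ) (y : Cfg N) (u : V3) (m : ℕ), 0 < r →
    (fun i => tpow r (velAfter σ N y m i - u)) =
      tTransport r σ N y 0 m (fun k => tpow r ((y k).2 - u)) +
        ∑ l ∈ Finset.range m, tTransport r σ N y (l + 1) (m - (l + 1)) (src r σ N y u l)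

/-! ## Fold bookkeeping -/

variable {r : ℕ} {σ : ℝ} {N : ℕ} {y : Cfg N}

theorem tStep_add (k : ℕ) (S T : Fin (N + 1) → Tens r) :
    tStep r σ N y k (S + T) = tStep r σ N y k S + tStep r σ N y k T := by
  unfold tStep
  cases hsp : stepPair σ N y k with
  | none => rfl
  | some ij =>
    funext p
    simp only [Pi.add_apply, Function.update_apply]
    split_ifs <;> simp only [mapT_add] <;> abel

theorem tStep_zero (k : ℕ) : tStep r σ N y k (0 : Fin (N + 1) → Tens r) = 0 := by
  have h := tStep_add (r := r) (σ := σ) (y := y) k 0 0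
  rw [add_zero] at h
  exact left_eq_add.1 h

theorem tStep_sum (k : ℕ) (s : Finset ℕ) (F : ℕ → Fin (N + 1) → Tens r) :
    tStep r σ N y k (∑ l ∈ s, F l) = ∑ l ∈ s, tStep r σ N y k (F l) := by
  induction s using Finset.induction_on with
  | empty => simp [tStep_zero]
  | insert a s ha ih => rw [Finset.sum_insert ha, Finset.sum_insert ha, tStep_add, ih]

theorem tTransport_zero (m₁ : ℕ) (T : Fin (N + 1) → Tens r) : tTransport r σ N y m₁ 0 T = T := rfl

theorem tTransport_succ (m₁ n : ℕ) (T : Fin (N + 1) → Tens r) :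
    tTransport r σ N y m₁ (n + 1) T = tStep r σ N y (m₁ + n) (tTransport r σ N y m₁ n T) := by
  unfold tTransport
  rw [List.range'_1_concat, List.foldl_append, List.foldl_cons, List.foldl_nil]

theorem velAfter_succ (m : ℕ) : velAfter σ N y (m + 1) = stepMap σ N y m (velAfter σ N y m) := by
  unfold velAfter transferSteps
  rw [List.range_succ, List.foldl_append, List.foldl_cons, List.foldl_nil]

/-! ## One step of the fold: reflection binomial + bookkeeping -/

theorem oneStep (hr : 0 < r) (u : V3) (m : ℕ) :
    (fun i => tpow r (velAfter σ N y (m + 1) i - u))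
      = tStep r σ N y m (fun i => tpow r (velAfter σ N y m i - u)) + src r σ N y u m := by
  set W := velAfter σ N y m with hW
  by_cases h : (Literature.Analysis.FluidPDE.Alexander.incomingPairs
      (Literature.Analysis.FluidPDE.Torus.geometry (Fin 3))
      (Literature.MathematicalPhysics.KineticTheory.hsDiameter σ N) (pre σ N y m)).Nonempty
  · -- a reflection of the pair `p = (i₀, j₀)`, `i₀ < j₀`, with normal `n`
    set p := h.some with hp
    have hpmem := h.some_mem
    rw [← hp] at hpmem
    have hlt : p.1 < p.2 := (Literature.Analysis.FluidPDE.Alexander.mem_incomingPairs.1 hpmem).1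
    have hij : p.1 ≠ p.2 := ne_of_lt hlt
    have hsp : stepPair σ N y m = some p := by
      unfold stepPair; rw [dif_pos h]
    set n : V3 := (Literature.Analysis.FluidPDE.Torus.geometry (Fin 3)).sepVec
      (pre σ N y m p.1).1 (pre σ N y m p.2).1 with hn
    have hsn : stepNormal σ N y m = n := by
      simp only [stepNormal, hsp]
      rfl
    have hvel : velAfter σ N y (m + 1) = fun i => (Literature.Analysis.FluidPDE.collidePair
        (Literature.Analysis.FluidPDE.Torus.geometry (Fin 3)) p.1 p.2
        (fun j => ((pre σ N y m j).1, W j)) i).2 := by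
      rw [velAfter_succ]; unfold stepMap; rw [dif_pos h]
    set c : ℝ := inner ℝ (W p.1 - W p.2) n / ‖n‖ ^ 2 with hc
    have hc' : c = inner ℝ n (W p.1 - u) / ‖n‖ ^ 2 - inner ℝ n (W p.2 - u) / ‖n‖ ^ 2 := by
      rw [hc, real_inner_comm, ← sub_div, ← inner_sub_right]
      congr 2
      abel
    have V1 : W p.1 - c • n - u = coprojV n (W p.1 - u) + projV n (W p.2 - u) := by
      rw [hc']; simp only [coprojV, projV]; module
    have V2 : W p.2 + c • n - u = coprojV n (W p.2 - u) + projV n (W p.1 - u) := by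
      rw [hc']; simp only [coprojV, projV]; module
    funext k
    simp only [Pi.add_apply, tStep, src, hsp, hsn, hvel]
    by_cases hk2 : k = p.2
    · subst hk2
      rw [Literature.Analysis.FluidPDE.collidePair_apply_right]
      simp only [Literature.Analysis.FluidPDE.reflectVel, Function.update_self]
      rw [← tpow_reflect hr n (W p.2 - u) (W p.1 - u), ← V2]
    · by_cases hk1 : k = p.1
      · subst hk1
        rw [Literature.Analysis.FluidPDE.collidePair_apply_left hij]
        simp only [Literature.Analysis.FluidPDE.reflectVel, Function.update_of_ne hk2,
          Function.update_self]
        rw [← tpow_reflect hr n (W p.1 - u) (W p.2 - u), ← V1]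
      · rw [Literature.Analysis.FluidPDE.collidePair_apply_of_ne hk1 hk2]
        simp only [Function.update_of_ne hk2, Function.update_of_ne hk1, Pi.zero_apply, add_zero]
  · -- identity step
    have hsp : stepPair σ N y m = none := by
      unfold stepPair; rw [dif_neg h]
    have hvel : velAfter σ N y (m + 1) = W := by
      rw [velAfter_succ]; unfold stepMap; rw [dif_neg h]
    simp only [tStep, src, hsp, hvel, add_zero]

/-! ## The Duhamel identity (stub 1 of the line) -/

/-- **`stub_duhamel`, proved**: variation of constants along the typed fold, every rank `r ≥ 1`. -/
theorem duhamel_holds : ∀ σ : ℝ, DuhamelIdentity σ := by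
  intro σ r N y u m hr
  induction m with
  | zero =>
    funext i
    simp [tTransport_zero, velAfter, transferSteps]
  | succ m ih =>
    rw [oneStep hr u m, ih, tStep_add, tStep_sum, Finset.sum_range_succ, Nat.sub_self,
      tTransport_zero, tTransport_succ, zero_add, ← add_assoc]
    congr 1
    congr 1
    refine Finset.sum_congr rfl fun l hl => ?_
    have hl' : l + 1 ≤ m := Finset.mem_range.1 hl
    have : m + 1 - (l + 1) = (m - (l + 1)) + 1 := by omega
    rw [this, tTransport_succ, Nat.add_sub_cancel' hl']

end

end Summit.AtomisticToContinuum.HydrodynamicLimit.Cruxes.AdaptedWeightCLT.ContactSourceDuhamel.DrefuteDuhamel
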